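import Summits.SmoothPoincare4.SmoothPoincare4.Theses.WeakReductionDescent
import Summits.SmoothPoincare4.SmoothPoincare4.Theorems.DependentTripleAtThree.Negative.OfSmoothPoincare4
import Literature.Topology.FourManifolds.HomotopyS4CompactProofs
import Literature.Topology.FourManifolds.HomotopyS4OrientableProofs
import Literature.Topology.FourManifolds.TrisectionEulerProofs
import Literature.Topology.FourManifolds.TrisectionHandleDecompositionProofs

/-!
# Crux `WeakReductionDescent.DependentTripleAtThree` (stmt-SmoothPoincare4-17999) — line `Sketch`,
# lead's skeleton (cycle 1): rung 3 ⇐ item stmt-SmoothPoincare4-0435 + Gay–Kirby Lemma 13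

Line `Sketch` = `Cruxes/DependentTripleAtThree/Ideator1Sketch.lean` (cards `poenaru-one-cork-up`,
`simplified-monodromy-genus-three`).  The lead drives the card-1 TRANSFER to the existing item
stmt-SmoothPoincare4-0435 (`GroupTrisection.GtriMorse1121`), see `PICKED.md`.

At rung `g = 3` "minimal" means "exotic": a diffeomorphism `M ≅ S⁴` pulls Gay–Kirby's genus-`0`
trisection of `S⁴` back to `M` and kills the minimality hypothesis
(`Theorems.DependentTripleAtThree.Negative.not_minimal_three_of_diffeomorph`, LANDED p158116), so the crux
follows by VACUITY from "every smooth homotopy 4-sphere with a genus-3 GK-trisection is `≅ S⁴`".  That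
statement is reached from two registered stubs:

* `stub_factGKLemma13` — the tree's named fact
  `Literature.Topology.FourManifolds.gkTrisection_exists_isMorse_isSelfIndexing` VERBATIM (Gay–Kirby 2016
  Lemma 13 / MSZ16 §4: a `(g; k₀,k₁,k₂)` GK-trisection of a closed connected oriented smooth 4-manifold
  gives a self-indexing Morse function with `(1, k₀, g − k₁, k₂, 1)` critical points).  KNOWN theorem,
  UNPROVED in tree (`TrisectionHandleDecompositionProofs.lean`: bookkeeping half proved; the geometric half
  waits on `waldhausen_heegaardSplitting_sumS1S2_unique` + Laudenbach–Poénaru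
  `exists_diffeomorph_comp_incl_eq`).  It closes by `exact gkTrisection_exists_isMorse_isSelfIndexing_holds`
  the day the fact is discharged.
* `stub_gtriMorse1121` — the signature of item stmt-SmoothPoincare4-0435
  (`Summit.SmoothPoincare4.SmoothPoincare4.Theses.GroupTrisection.GtriMorse1121`) VERBATIM: a closed smooth
  `M ≃ₕ S⁴` with a Morse function with one minimum, `≤ 1` critical point of index 1, `≤ 1` of index 3 and
  one maximum is `≅ S⁴`.  OPEN in its `(c₁,c₃) = (1,1)` case (= Mazur doubles / two 2-handles on `S¹×S²`
  returning `S¹×S²`); the hub's convergence point (crux stmt-SmoothPoincare4-3546, skeleton m12, registers the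
  same stub; `Theorems/ContractibleTwistedDoubleStandard/Negative/GtriMorse1121Sector.lean`, p117184).

Composition (sorry-free, this file): `Σ kᵢ = 3` UNCONDITIONALLY for a genus-3 GK-trisection of a homotopy
sphere (`gkTrisection_genus_eq_sum_of_homotopyEquiv_sphere_holds`, PROVED), hence two of the `kᵢ` are `≤ 1`
and a relabelling `σ` of the sectors (`IsGKTrisection.comp_perm`, PROVED) puts them in slots `0` and `2`;
GK Lemma 13 for the relabelled trisection gives a Morse function of profile `(1, ≤1, ·, ≤1, 1)`
(`morseOneOne_of_gkLemma13`); 0435 gives `M ≅ S⁴` (`genusThreeStandard_of_pieces`); vacuity gives the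
crux (`DependentTripleAtThree_of`, the ONLY theorem here whose type is the crux decl).
NO MSZ16 input is needed (the non-(1,1,1) types are absorbed by the relabelling, not emptied).

Honest status (BirthAttack / Negative lane): the crux is SPC4-shielded and, modulo AZ25 Thm 1.4 + MSZ16,
EQUIVALENT to the open (3;1,1,1) frontier; this skeleton is closed modulo {GK L13 (tree debt), item 0435
(open problem)} and nothing provable is left outside those two stubs.
-/

noncomputable section

set_option linter.dupNamespace false

open scoped Manifold ContDiff Topology ContinuousMap
open Set Function Literature.Topology.FourManifolds
open Summit.SmoothPoincare4.SmoothPoincare4.Theses.WeakReductionDescent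

namespace Summit.SmoothPoincare4.SmoothPoincare4.Cruxes.DependentTripleAtThree.Sketch

/-- The round `4`-sphere of Mathlib. -/
local notation "𝕊⁴" => (Metric.sphere (0 : EuclideanSpace ℝ (Fin 5)) 1)

/-! ## The two registered stubs -/

/-- **Stub 1 — Gay–Kirby 2016 Lemma 13, the tree's named fact VERBATIM**
(`Literature.Topology.FourManifolds.gkTrisection_exists_isMorse_isSelfIndexing`): a `(g; k 0, k 1, k 2)`
GK-trisection of a closed connected oriented smooth 4-manifold yields a self-indexing Morse function with
exactly `(1, k 0, g - k 1, k 2, 1)` critical points of index `(0,1,2,3,4)`.  Known theorem, unproved in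
tree (geometric half waits on Waldhausen + Laudenbach–Poénaru). -/
theorem stub_factGKLemma13 :
    Literature.Topology.FourManifolds.gkTrisection_exists_isMorse_isSelfIndexing := by
  sorry

/-- **Stub 2 — item stmt-SmoothPoincare4-0435 `GroupTrisection.GtriMorse1121` VERBATIM** (apex, OPEN in
its `(c₁,c₃) = (1,1)` case): a closed smooth `M ≃ₕ S⁴` carrying a Morse function with one minimum, at most
one critical point of index `1`, at most one of index `3` and one maximum is diffeomorphic to `S⁴`. -/
theorem stub_gtriMorse1121 :
    ∀ (M : Type) [TopologicalSpace M] [T2Space M] [SecondCountableTopology M] [ChartedSpace (EuclideanSpace ℝ (Fin 4)) M] [IsManifold (𝓡 4) ((⊤ : ℕ∞) : WithTop ℕ∞) M] [CompactSpace M], M ≃ₕ Metric.sphere (0 : EuclideanSpace ℝ (Fin 5)) 1 → ∀ f : M → ℝ, Literature.Topology.FourManifolds.IsMorse (𝓡 4) f → (Literature.Topology.FourManifolds.criticalSetOfIndex (𝓡 4) f 0).ncard = 1 → (Literature.Topology.FourManifolds.criticalSetOfIndex (𝓡 4) f 1).ncard ≤ 1 → (Literature.Topology.FourManifolds.criticalSetOfIndex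 (𝓡 4) f 3).ncard ≤ 1 → (Literature.Topology.FourManifolds.criticalSetOfIndex (𝓡 4) f 4).ncard = 1 → Nonempty (Diffeomorph (𝓡 4) (𝓡 4) M (Metric.sphere (0 : EuclideanSpace ℝ (Fin 5)) 1) ((⊤ : ℕ∞) : WithTop ℕ∞)) := by
  sorry

/-! ## Glue (proved): the type of a genus-3 trisection of a homotopy sphere, relabelling, the handle reading -/

section Glue

variable {M : Type} [TopologicalSpace M] [T2Space M] [SecondCountableTopology M]
  [ChartedSpace (EuclideanSpace ℝ (Fin 4)) M] [IsManifold (𝓡 4) ∞ M]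

/-- `M ≃ₕ S⁴` is compact (proved tree fact). [cite: HatcherAT2002, Prop. 3.29 and Cor. 2.11] -/
theorem compactSpace_of_he (e : M ≃ₕ 𝕊⁴) : CompactSpace M :=
  compactSpace_of_homotopyEquiv_sphere_four_holds M e

omit [T2Space M] [SecondCountableTopology M] [ChartedSpace (EuclideanSpace ℝ (Fin 4)) M]
  [IsManifold (𝓡 4) ∞ M] in
/-- `M ≃ₕ S⁴` is connected (path-connectedness of `S⁴` transported along `e`). [folklore] -/
theorem connectedSpace_of_he (e : M ≃ₕ 𝕊⁴) : ConnectedSpace M := by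
  haveI : PathConnectedSpace 𝕊⁴ := pathConnectedSpace_sphere_four
  haveI : PathConnectedSpace M := pathConnectedSpace_of_homotopyEquiv e
  infer_instance

/-- **`Σ kᵢ = 3`, unconditionally**, for a genus-`3` GK-trisection of a smooth homotopy 4-sphere (the
PROVED Euler-characteristic fact `χ = 2 + g − Σ kᵢ`). [cite: GayKirby2016, Remark 2] -/
theorem sum_k_eq_three (e : M ≃ₕ 𝕊⁴) {k : Fin 3 → ℕ} {T : Fin 3 → Set M}
    (hT : IsGKTrisection M 3 k T) : k 0 + k 1 + k 2 = 3 := by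
  haveI := compactSpace_of_he e
  obtain ⟨o⟩ := isOrientable_of_homotopyEquiv_sphere_four_holds M e
  exact (gkTrisection_genus_eq_sum_of_homotopyEquiv_sphere_holds M o 3 k T hT e).symm

/-- **Relabelling.** Three naturals summing to `3` contain two that are `≤ 1`; a permutation of `Fin 3`
moves them to the slots `0` and `2`. [folklore] -/
theorem exists_perm_apply_le_one {k : Fin 3 → ℕ} (hk : k 0 + k 1 + k 2 = 3) :
    ∃ σ : Equiv.Perm (Fin 3), k (σ 0) ≤ 1 ∧ k (σ 2) ≤ 1 := by
  by_cases h0 : k 0 ≤ 1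
  · by_cases h2 : k 2 ≤ 1
    · exact ⟨1, by simpa using h0, by simpa using h2⟩
    · have h1 : k 1 ≤ 1 := by omega
      refine ⟨Equiv.swap 1 2, ?_, ?_⟩
      · rw [Equiv.swap_apply_of_ne_of_ne (by decide) (by decide)]; exact h0
      · rw [Equiv.swap_apply_right]; exact h1
  · have h1 : k 1 ≤ 1 := by omega
    have h2 : k 2 ≤ 1 := by omega
    refine ⟨Equiv.swap 0 1, ?_, ?_⟩
    · rw [Equiv.swap_apply_left]; exact h1
    · rw [Equiv.swap_apply_of_ne_of_ne (by decide) (by decide)]; exact h2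

/-- **The handle reading (GK Lemma 13 ⇒ profile `(1, ≤1, ·, ≤1, 1)`).** Given the named fact, a smooth
homotopy 4-sphere with a genus-`3` GK-trisection of ANY type `k` carries a Morse function with one minimum,
`≤ 1` critical point of index `1`, `≤ 1` of index `3` and one maximum: `Σ kᵢ = 3`, relabel so that
`k (σ 0), k (σ 2) ≤ 1`, and read Lemma 13 for the relabelled trisection
(`gkTrisection_exists_isMorse_isSelfIndexing.comp_perm`). [cite: GayKirby2016, Lemma 13] -/
theorem morseOneOne_of_gkLemma13 (hGK : gkTrisection_exists_isMorse_isSelfIndexing)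
    (e : M ≃ₕ 𝕊⁴) {k : Fin 3 → ℕ} {T : Fin 3 → Set M} (hT : IsGKTrisection M 3 k T) :
    ∃ f : M → ℝ, IsMorse (𝓡 4) f ∧
      (criticalSetOfIndex (𝓡 4) f 0).ncard = 1 ∧ (criticalSetOfIndex (𝓡 4) f 1).ncard ≤ 1 ∧
      (criticalSetOfIndex (𝓡 4) f 3).ncard ≤ 1 ∧ (criticalSetOfIndex (𝓡 4) f 4).ncard = 1 := by
  haveI := compactSpace_of_he e
  haveI := connectedSpace_of_he e
  obtain ⟨o⟩ := isOrientable_of_homotopyEquiv_sphere_four_holds M e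
  obtain ⟨σ, h0, h2⟩ := exists_perm_apply_le_one (sum_k_eq_three e hT)
  obtain ⟨f, hf, -, c0, c1, -, c3, c4⟩ := hGK.comp_perm o hT σ
  exact ⟨f, hf, c0, c1.trans_le h0, c3.trans_le h2, c4⟩

end Glue

/-! ## The composition, sorry-free, concluding the crux BY NAME -/

/-- **GK Lemma 13 → item 0435 → every smooth homotopy 4-sphere with a genus-`3` GK-trisection is `≅ S⁴`**
(the manifold-level statement `GenusThreeStandard` of the Sketch, any type `k`), from the two hypotheses
taken as arguments (this theorem does NOT conclude the crux; only `DependentTripleAtThree_of` does).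
[cite: GayKirby2016, Lemma 13] -/
theorem genusThreeStandard_of_pieces (hGK : gkTrisection_exists_isMorse_isSelfIndexing)
    (h0435 : ∀ (M : Type) [TopologicalSpace M] [T2Space M] [SecondCountableTopology M] [ChartedSpace (EuclideanSpace ℝ (Fin 4)) M] [IsManifold (𝓡 4) ((⊤ : ℕ∞) : WithTop ℕ∞) M] [CompactSpace M], M ≃ₕ Metric.sphere (0 : EuclideanSpace ℝ (Fin 5)) 1 → ∀ f : M → ℝ, Literature.Topology.FourManifolds.IsMorse (𝓡 4) f → (Literature.Topology.FourManifolds.criticalSetOfIndex (𝓡 4) f 0).ncard = 1 → (Literature.Topology.FourManifolds.criticalSetOfIndex (𝓡 4) f 1).ncard ≤ 1 → (Literature.Topology.FourManifolds.criticalSetOfIndex (𝓡 4) f 3).ncard ≤ 1 → (Literature.Topology.FourManifolds.criticalSetOfIndex (𝓡 4) f 4).ncard = 1 → Nonempty (Diffeomorph (𝓡 4) (𝓡 4) M (Metric.sphere (0 : EuclideanSpace ℝ (Fin 5)) 1) ((⊤ : ℕ∞) : WithTop ℕ∞)))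
    {M : Type} [TopologicalSpace M] [T2Space M] [SecondCountableTopology M]
    [ChartedSpace (EuclideanSpace ℝ (Fin 4)) M] [IsManifold (𝓡 4) ∞ M]
    (e : M ≃ₕ 𝕊⁴) {k : Fin 3 → ℕ} {T : Fin 3 → Set M} (hT : IsGKTrisection M 3 k T) :
    Nonempty (M ≃ₘ⟮𝓡 4, 𝓡 4⟯ 𝕊⁴) := by
  haveI : CompactSpace M := hT.compactSpace
  obtain ⟨f, hf, c0, c1, c3, c4⟩ := morseOneOne_of_gkLemma13 hGK e hT
  exact h0435 M e f hf c0 c1 c3 c4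

/-- **THE SKELETON THEOREM: the crux `DependentTripleAtThree` BY NAME from the two registered stubs.**
For a minimal genus-`3` GK-trisection of `M ≃ₕ S⁴`: the handle reading (`stub_factGKLemma13`) gives a
Morse function of profile `(1, ≤1, ·, ≤1, 1)`, `stub_gtriMorse1121` gives `Φ : M ≅ S⁴`, and `Φ`
contradicts minimality (genus-`0` trisection of `S⁴` pulled back,
`Theorems.DependentTripleAtThree.Negative.not_minimal_three_of_diffeomorph`) — the rung is EMPTY, so the
dependent triple exists vacuously. -/
theorem DependentTripleAtThree_of : DependentTripleAtThree := by
  intro M _ _ _ _ _ e k T hT hmin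
  obtain ⟨Φ⟩ := genusThreeStandard_of_pieces stub_factGKLemma13 stub_gtriMorse1121 e hT
  exact (Theorems.DependentTripleAtThree.Negative.not_minimal_three_of_diffeomorph Φ hmin).elim

end Summit.SmoothPoincare4.SmoothPoincare4.Cruxes.DependentTripleAtThree.Sketch

end
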